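import Mathlib
import HarnessLib
import Literature.ModelTheory.FiniteModelTheory.StructCkEquiv
import Summits.ValiantsHypothesis.ValiantsHypothesis.Theorems.SymmetryDialAffinePebbleFour

/-!
# SymmetryDial — four pebble pairs with dual pebbles: derivative-spectrum and subspace pattern counts

Route `SymmetryDial` (workshop `decomp-valiant`, lens 1, gen 8, Addendum B (c′)), item 23711 (P′ = `AffinePebblePairs`).
Companion of `SymmetryDialAffinePebbleFour` (the (T)-filter: point triples).  Round 1 of the 4-pebble game on the
two-sorted affine Cayley structure `𝔄(M_f)` also reads, with ONE dual pebble `θ` and a point pair `(a,b)`, the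
DERIVATIVE-SPECTRUM pattern counts `derivCount f θ a b ε = #{x : [θ·(a+x) = 0] = ε₁ ∧ f(a+x) = ε₂ ∧ f(b+x) = ε₃}`
(their signed sums are the Walsh coefficients `𝒲[D_{a+b} f](θ)` of the derivatives), and with TWO dual pebbles
`θ, ζ` and a point `a` the SUBSPACE pattern counts `subspaceCount f θ ζ a ε = #{x : [θ·(a+x)=0] = ε₁ ∧ [ζ·(a+x)=0] = ε₂
∧ f(a+x) = ε₃}` (restrictions of `f` to the cosets of `⟨θ,ζ⟩^⊥`, i.e. the 2-dimensional decompositions of the dual).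
**Theorems** `derivCount_of_pebbleEquiv_four`, `subspaceCount_of_pebbleEquiv_four`: affine `C⁴`-equivalence gives
nested bijections (points to points, duals to duals) matching these counts; `derivProfile_multiset_eq` and
`not_pebbleEquiv_of_derivProfile_ne` are the census forms (the (Δ)-filter; on the E1 habitat it is what separates
`1+Tr(xy)` from `Tr(xy)+[y=0]` at round 1, Addendum B §B.2).  Instrument side only; nothing here bears on VP ≠ VNP.
-/

namespace Summit.ValiantsHypothesis.ValiantsHypothesis.Theorems.SymmetryDialAffinePebbleFourDual

open Finset
open Literature.ModelTheory.FiniteModelTheory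
open SymmetryDialAffinePebble (V AffRel Laff pair RelHolds affStr AffinePebbleEquiv affinePebbleEquiv_mono)
open SymmetryDialAffinePebbleThree (grpMat exists_inl_of_partialIso exists_inr_of_partialIso mat_iff_of_partialIso
  inc_iff_of_partialIso)
open SymmetryDialAffinePebbleFour (eq_iff_eq_of_iff)

variable {d : ℕ}

/-! ## §1 Duplicator's moves yield bijections of points and of duals -/

section Moves

variable {k : ℕ} {A B : V d × V d → Bool} (S : PebbleStrategySpace k (V d ⊕ V d) (V d ⊕ V d))
  (hS : ∀ ⦃p⦄, p ∈ S.positions →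
    @PebblePosition.IsPartialIso k (V d ⊕ V d) (V d ⊕ V d) Laff (affStr A) (affStr B) p)
include hS

/-- Moving pebble `i` onto a POINT: a bijection of points keeping the position in the strategy. -/
theorem exists_point_bijection {p : PebblePosition k (V d ⊕ V d) (V d ⊕ V d)} (hp : p ∈ S.positions)
    (i : Fin k) : ∃ e : V d → V d, Function.Bijective e ∧
      ∀ a, Function.update p i (some (Sum.inl a, Sum.inl (e a))) ∈ S.positions := by
  obtain ⟨φ, hφ⟩ := S.move hp i
  have he : ∀ a : V d, ∃ a' : V d, φ (.inl a) = .inl a' := fun a =>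
    exists_inl_of_partialIso (hS (hφ (.inl a)))
      (show PebblePosition.Pebbled (Function.update p i (some (Sum.inl a, φ (Sum.inl a))))
        (Sum.inl a) (φ (Sum.inl a)) from ⟨i, by simp⟩)
  choose e he using he
  have hinj : Function.Injective e := fun a b hab =>
    Sum.inl_injective (φ.injective (by rw [he a, he b, hab]))
  refine ⟨e, ⟨hinj, Finite.surjective_of_injective hinj⟩, fun a => ?_⟩
  have := hφ (.inl a); rwa [he a] at this

/-- Moving pebble `i` onto a DUAL: a bijection of duals keeping the position in the strategy. -/
theorem exists_dual_bijection {p : PebblePosition k (V d ⊕ V d) (V d ⊕ V d)} (hp : p ∈ S.positions)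
    (i : Fin k) : ∃ δ : V d → V d, Function.Bijective δ ∧
      ∀ θ, Function.update p i (some (Sum.inr θ, Sum.inr (δ θ))) ∈ S.positions := by
  obtain ⟨φ, hφ⟩ := S.move hp i
  have he : ∀ θ : V d, ∃ θ' : V d, φ (.inr θ) = .inr θ' := fun θ =>
    exists_inr_of_partialIso (hS (hφ (.inr θ)))
      (show PebblePosition.Pebbled (Function.update p i (some (Sum.inr θ, φ (Sum.inr θ))))
        (Sum.inr θ) (φ (Sum.inr θ)) from ⟨i, by simp⟩)
  choose δ hδ using he
  have hinj : Function.Injective δ := fun a b hab =>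
    Sum.inr_injective (φ.injective (by rw [hδ a, hδ b, hab]))
  refine ⟨δ, ⟨hinj, Finite.surjective_of_injective hinj⟩, fun θ => ?_⟩
  have := hφ (.inr θ); rwa [hδ θ] at this

end Moves

/-- `decide` bookkeeping: from `P ↔ Q` to `decide P = ε ↔ decide Q = ε`. -/
theorem decide_eq_iff_of_iff {P Q : Prop} [Decidable P] [Decidable Q] (h : P ↔ Q) (ε : Bool) :
    decide P = ε ↔ decide Q = ε := by
  have : decide P = decide Q := by
    by_cases hP : P
    · rw [decide_eq_true hP, decide_eq_true (h.1 hP)]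
    · rw [decide_eq_false hP, decide_eq_false (fun hQ => hP (h.2 hQ))]
  rw [this]

/-! ## §2 One dual pebble: derivative-spectrum pattern counts -/

/-- `#{x : [θ·(a+x) = 0] = ε₁ ∧ f(a+x) = ε₂ ∧ f(b+x) = ε₃}`. -/
def derivCount (f : V d → Bool) (θ a b : V d) (ε : Bool × Bool × Bool) : ℕ :=
  ((univ : Finset (V d)).filter fun x =>
    decide (pair θ (a + x) = 0) = ε.1 ∧ f (a + x) = ε.2.1 ∧ f (b + x) = ε.2.2).card

/-- The derivative-spectrum pattern-count vector of `(a, b, θ)`. -/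
def derivProfile (f : V d → Bool) (t : V d × V d × V d) : Bool × Bool × Bool → ℕ :=
  fun ε => derivCount f t.2.2 t.1 t.2.1 ε

/-- **The (Δ)-filter.**  Affine `C⁴`-equivalence ⇒ nested bijections (points `a ↦ a'`, points `b ↦ b'`,
duals `θ ↦ θ'`) matching all derivative-spectrum pattern counts. -/
theorem derivCount_of_pebbleEquiv_four (f g : V d → Bool)
    (h : AffinePebbleEquiv 4 d (grpMat f) (grpMat g)) :
    ∃ e₁ : V d → V d, Function.Bijective e₁ ∧ ∀ a, ∃ e₂ : V d → V d, Function.Bijective e₂ ∧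
      ∀ b, ∃ δ : V d → V d, Function.Bijective δ ∧
        ∀ θ ε, derivCount f θ a b ε = derivCount g (δ θ) (e₁ a) (e₂ b) ε := by
  classical
  obtain ⟨S, hS⟩ := h
  obtain ⟨e₁, he₁, h₁⟩ := exists_point_bijection S hS S.empty_mem 0
  refine ⟨e₁, he₁, fun a => ?_⟩
  set p₁ := Function.update (PebblePosition.empty : PebblePosition 4 (V d ⊕ V d) (V d ⊕ V d)) 0
    (some (Sum.inl a, Sum.inl (e₁ a))) with hp₁
  obtain ⟨e₂, he₂, h₂⟩ := exists_point_bijection S hS (h₁ a) 1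
  refine ⟨e₂, he₂, fun b => ?_⟩
  set p₂ := Function.update p₁ 1 (some (Sum.inl b, Sum.inl (e₂ b))) with hp₂
  obtain ⟨δ, hδ, h₃⟩ := exists_dual_bijection S hS (h₂ b) 2
  refine ⟨δ, hδ, fun θ ε => ?_⟩
  set p₃ := Function.update p₂ 2 (some (Sum.inr θ, Sum.inr (δ θ))) with hp₃
  obtain ⟨e₄, he₄, h₄⟩ := exists_point_bijection S hS (h₃ θ) 3
  set q : V d → PebblePosition 4 (V d ⊕ V d) (V d ⊕ V d) :=
    fun x => Function.update p₃ 3 (some (Sum.inl x, Sum.inl (e₄ x))) with hq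
  have hq_mem : ∀ x, q x ∈ S.positions := h₄
  have hq0 : ∀ x, (q x) 0 = some (Sum.inl a, Sum.inl (e₁ a)) := fun x => by
    simp only [hq]
    rw [Function.update_of_ne (by decide), hp₃, Function.update_of_ne (by decide), hp₂,
      Function.update_of_ne (by decide), hp₁, Function.update_self]
  have hq1 : ∀ x, (q x) 1 = some (Sum.inl b, Sum.inl (e₂ b)) := fun x => by
    simp only [hq]
    rw [Function.update_of_ne (by decide), hp₃, Function.update_of_ne (by decide), hp₂,
      Function.update_self]
  have hq2 : ∀ x, (q x) 2 = some (Sum.inr θ, Sum.inr (δ θ)) := fun x => by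
    simp only [hq]
    rw [Function.update_of_ne (by decide), hp₃, Function.update_self]
  have hq3 : ∀ x, (q x) 3 = some (Sum.inl x, Sum.inl (e₄ x)) := fun x => by
    simp only [hq]
    rw [Function.update_self]
  have hmat : ∀ x (u u' : V d) (j : Fin 4), (q x) j = some (Sum.inl u, Sum.inl u') →
      ∀ ε', (f (u + x) = ε' ↔ g (u' + e₄ x) = ε') := fun x u u' j hj ε' =>
    eq_iff_eq_of_iff (mat_iff_of_partialIso (hS (hq_mem x)) ⟨j, hj⟩ ⟨3, hq3 x⟩) ε'
  have hinc : ∀ x ε', (decide (pair θ (a + x) = 0) = ε' ↔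
      decide (pair (δ θ) (e₁ a + e₄ x) = 0) = ε') := fun x ε' =>
    decide_eq_iff_of_iff (inc_iff_of_partialIso (hS (hq_mem x)) ⟨2, hq2 x⟩ ⟨0, hq0 x⟩ ⟨3, hq3 x⟩) ε'
  unfold derivCount
  refine card_bij (fun x _ => e₄ x) (fun x hx => ?_) (fun x _ y _ hxy => he₄.1 hxy) (fun y hy => ?_)
  · obtain ⟨-, hx1, hx2, hx3⟩ := mem_filter.1 hx
    exact mem_filter.2 ⟨mem_univ _, (hinc x _).1 hx1, (hmat x a _ 0 (hq0 x) _).1 hx2,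
      (hmat x b _ 1 (hq1 x) _).1 hx3⟩
  · obtain ⟨x, rfl⟩ := he₄.2 y
    obtain ⟨-, hy1, hy2, hy3⟩ := mem_filter.1 hy
    exact ⟨x, mem_filter.2 ⟨mem_univ _, (hinc x _).2 hy1, (hmat x a _ 0 (hq0 x) _).2 hy2,
      (hmat x b _ 1 (hq1 x) _).2 hy3⟩, rfl⟩

/-- **Corollary: equal multisets of derivative-spectrum profiles over all (a, b, θ).** -/
theorem derivProfile_multiset_eq (f g : V d → Bool) (h : AffinePebbleEquiv 4 d (grpMat f) (grpMat g)) :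
    (univ : Finset (V d × V d × V d)).val.map (derivProfile f) =
      (univ : Finset (V d × V d × V d)).val.map (derivProfile g) := by
  classical
  obtain ⟨e₁, he₁, h₁⟩ := derivCount_of_pebbleEquiv_four f g h
  choose e₂ he₂ h₂ using h₁
  choose δ hδ h₃ using h₂
  let T : V d × V d × V d → V d × V d × V d :=
    fun t => (e₁ t.1, e₂ t.1 t.2.1, δ t.1 t.2.1 t.2.2)
  have hT : Function.Injective T := by
    rintro ⟨a, b, c⟩ ⟨a', b', c'⟩ hh
    simp only [T, Prod.mk.injEq] at hh
    obtain ⟨ha, hb, hc⟩ := hh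
    have ha' : a = a' := he₁.1 ha
    subst ha'
    have hb' : b = b' := (he₂ a).1 hb
    subst hb'
    have hc' : c = c' := (hδ a b).1 hc
    subst hc'
    rfl
  have hTb : Function.Bijective T := ⟨hT, Finite.surjective_of_injective hT⟩
  have hprof : ∀ t, derivProfile f t = derivProfile g (T t) := by
    rintro ⟨a, b, c⟩
    funext ε
    exact h₃ a b c ε
  have h1 : (univ : Finset (V d × V d × V d)).val.map (derivProfile f) =
      (univ : Finset (V d × V d × V d)).val.map (derivProfile g ∘ T) :=
    Multiset.map_congr rfl fun t _ => hprof t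
  rw [h1, ← Multiset.map_map]
  congr 1
  exact (Multiset.map_univ_val_equiv (Equiv.ofBijective T hTb))

/-- Contrapositive, the census form of the (Δ)-filter (every `k′ ≥ 4`). -/
theorem not_pebbleEquiv_of_derivProfile_ne {k' : ℕ} (hk : 4 ≤ k') (f g : V d → Bool)
    (hne : (univ : Finset (V d × V d × V d)).val.map (derivProfile f) ≠
      (univ : Finset (V d × V d × V d)).val.map (derivProfile g)) :
    ¬ AffinePebbleEquiv k' d (grpMat f) (grpMat g) :=
  fun h => hne (derivProfile_multiset_eq f g (affinePebbleEquiv_mono hk h))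

/-! ## §3 Two dual pebbles: subspace pattern counts -/

/-- `#{x : [θ·(a+x) = 0] = ε₁ ∧ [ζ·(a+x) = 0] = ε₂ ∧ f(a+x) = ε₃}`. -/
def subspaceCount (f : V d → Bool) (θ ζ a : V d) (ε : Bool × Bool × Bool) : ℕ :=
  ((univ : Finset (V d)).filter fun x =>
    decide (pair θ (a + x) = 0) = ε.1 ∧ decide (pair ζ (a + x) = 0) = ε.2.1 ∧ f (a + x) = ε.2.2).card

/-- **The (Σ)-filter.**  Affine `C⁴`-equivalence ⇒ nested bijections (points `a ↦ a'`, duals `θ ↦ θ'`,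
duals `ζ ↦ ζ'`) matching all subspace pattern counts. -/
theorem subspaceCount_of_pebbleEquiv_four (f g : V d → Bool)
    (h : AffinePebbleEquiv 4 d (grpMat f) (grpMat g)) :
    ∃ e₁ : V d → V d, Function.Bijective e₁ ∧ ∀ a, ∃ δ₁ : V d → V d, Function.Bijective δ₁ ∧
      ∀ θ, ∃ δ₂ : V d → V d, Function.Bijective δ₂ ∧
        ∀ ζ ε, subspaceCount f θ ζ a ε = subspaceCount g (δ₁ θ) (δ₂ ζ) (e₁ a) ε := by
  classical
  obtain ⟨S, hS⟩ := h
  obtain ⟨e₁, he₁, h₁⟩ := exists_point_bijection S hS S.empty_mem 0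
  refine ⟨e₁, he₁, fun a => ?_⟩
  set p₁ := Function.update (PebblePosition.empty : PebblePosition 4 (V d ⊕ V d) (V d ⊕ V d)) 0
    (some (Sum.inl a, Sum.inl (e₁ a))) with hp₁
  obtain ⟨δ₁, hδ₁, h₂⟩ := exists_dual_bijection S hS (h₁ a) 1
  refine ⟨δ₁, hδ₁, fun θ => ?_⟩
  set p₂ := Function.update p₁ 1 (some (Sum.inr θ, Sum.inr (δ₁ θ))) with hp₂
  obtain ⟨δ₂, hδ₂, h₃⟩ := exists_dual_bijection S hS (h₂ θ) 2
  refine ⟨δ₂, hδ₂, fun ζ ε => ?_⟩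
  set p₃ := Function.update p₂ 2 (some (Sum.inr ζ, Sum.inr (δ₂ ζ))) with hp₃
  obtain ⟨e₄, he₄, h₄⟩ := exists_point_bijection S hS (h₃ ζ) 3
  set q : V d → PebblePosition 4 (V d ⊕ V d) (V d ⊕ V d) :=
    fun x => Function.update p₃ 3 (some (Sum.inl x, Sum.inl (e₄ x))) with hq
  have hq_mem : ∀ x, q x ∈ S.positions := h₄
  have hq0 : ∀ x, (q x) 0 = some (Sum.inl a, Sum.inl (e₁ a)) := fun x => by
    simp only [hq]
    rw [Function.update_of_ne (by decide), hp₃, Function.update_of_ne (by decide), hp₂,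
      Function.update_of_ne (by decide), hp₁, Function.update_self]
  have hq1 : ∀ x, (q x) 1 = some (Sum.inr θ, Sum.inr (δ₁ θ)) := fun x => by
    simp only [hq]
    rw [Function.update_of_ne (by decide), hp₃, Function.update_of_ne (by decide), hp₂,
      Function.update_self]
  have hq2 : ∀ x, (q x) 2 = some (Sum.inr ζ, Sum.inr (δ₂ ζ)) := fun x => by
    simp only [hq]
    rw [Function.update_of_ne (by decide), hp₃, Function.update_self]
  have hq3 : ∀ x, (q x) 3 = some (Sum.inl x, Sum.inl (e₄ x)) := fun x => by
    simp only [hq]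
    rw [Function.update_self]
  have hmat : ∀ x ε', (f (a + x) = ε' ↔ g (e₁ a + e₄ x) = ε') := fun x ε' =>
    eq_iff_eq_of_iff (mat_iff_of_partialIso (hS (hq_mem x)) ⟨0, hq0 x⟩ ⟨3, hq3 x⟩) ε'
  have hinc : ∀ x (ξ ξ' : V d) (j : Fin 4), (q x) j = some (Sum.inr ξ, Sum.inr ξ') →
      ∀ ε', (decide (pair ξ (a + x) = 0) = ε' ↔ decide (pair ξ' (e₁ a + e₄ x) = 0) = ε') :=
    fun x ξ ξ' j hj ε' =>
      decide_eq_iff_of_iff (inc_iff_of_partialIso (hS (hq_mem x)) ⟨j, hj⟩ ⟨0, hq0 x⟩ ⟨3, hq3 x⟩) ε'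
  unfold subspaceCount
  refine card_bij (fun x _ => e₄ x) (fun x hx => ?_) (fun x _ y _ hxy => he₄.1 hxy) (fun y hy => ?_)
  · obtain ⟨-, hx1, hx2, hx3⟩ := mem_filter.1 hx
    exact mem_filter.2 ⟨mem_univ _, (hinc x θ _ 1 (hq1 x) _).1 hx1, (hinc x ζ _ 2 (hq2 x) _).1 hx2,
      (hmat x _).1 hx3⟩
  · obtain ⟨x, rfl⟩ := he₄.2 y
    obtain ⟨-, hy1, hy2, hy3⟩ := mem_filter.1 hy
    exact ⟨x, mem_filter.2 ⟨mem_univ _, (hinc x θ _ 1 (hq1 x) _).2 hy1, (hinc x ζ _ 2 (hq2 x) _).2 hy2,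
      (hmat x _).2 hy3⟩, rfl⟩

end Summit.ValiantsHypothesis.ValiantsHypothesis.Theorems.SymmetryDialAffinePebbleFourDual
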